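import Summits.CriticalPhenomena.SAWScalingLimit.Theses.SAWLaplacianWalk
import Summits.CriticalPhenomena.SAWScalingLimit.Theorems.SAWRenewalTightnessTightIdentificationGlue

/-!
# `SAWLaplacianWalk.Assembly` (stmt-CriticalPhenomena-4487): the assembly frame — proved

Route `SAWLaplacianWalk` of `CriticalPhenomena/SAWScalingLimit` (assembly item):

`BoundaryApprox → TipHarmonicLaw → HarmonicPassage → HarmonicIdentification → LimitsDescribable →
 EventualTight → SAWScalingLimit`.

This is the soft "identification + Prokhorov" tail of the route, with every analytic input taken
as a hypothesis (the route items) and every "known" input taken from THEOREMS of the tree: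

* chordal uniformizing maps exist (`MarkedDomain.exists_isChordalUniformizing_holds`,
  Riemann–Carathéodory) and extend continuously to the closed disc picture
  (`JordanDomain.exists_isDiscExtension`, Carathéodory), so that for every real `x ≠ 0` the
  boundary value `d₀ = φ(x)` is a boundary point of `D` different from both marked points;
* the tree's PROVED Prokhorov/Billingsley criterion for the critical SAW laws along the mesh,
  `saw_convergesInLawToSLE_of_isTightAlongMesh` (the laws are probability measures for all small
  `δ`, the curve observable is measurable, uniqueness of the chordal SLE_{8/3} law).

## Proof

Fix `(D; a, b)` and an endpoint approximation. `EventualTight` is tightness along the mesh, so by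
`saw_convergesInLawToSLE_of_isTightAlongMesh` it remains to identify every probability
subsequential limit law `ν` (`IsSubseqLimitLaw`) as the chordal SLE_{8/3} law. Take `φ` chordal
uniformizing; `LimitsDescribable` gives `ν`-a.e. Loewner-describability and source `= a`; for a
real `x ≠ 0` the point `d₀ := φ.boundaryExtension x` lies on `∂D` and is `≠ a, b`
(Carathéodory: the disc extension is injective on the closed disc), `BoundaryApprox` gives
lattice approximations `d_δ → d₀` joined to `a_δ`, and `HarmonicPassage` (fed `TipHarmonicLaw`)
gives the martingale cylinder identities of the harmonic `5/8`-observables `N^{x,m}` for this `x`;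
so the unbounded set `T := {x | x ≠ 0}` works and `HarmonicIdentification` yields
`IsSLELaw (8/3) D ν`.

## References

* A. Kemppainen, S. Smirnov, *Random curves, scaling limits and Loewner evolutions*, Ann.
  Probab. 45 (2017), Thm. 1.5 and Cor. 1.7 [KemppainenSmirnov2017].
* D. Chelkak, H. Duminil-Copin, C. Hongler, A. Kemppainen, S. Smirnov, *Convergence of Ising
  interfaces to Schramm's SLE curves*, C. R. Acad. Sci. Paris 352 (2014) [CDHKSCRAS2014].
* G. F. Lawler, O. Schramm, W. Werner, *On the scaling limit of planar self-avoiding walk*, Proc.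
  Sympos. Pure Math. 72 (2004), §3.4.2 and §4.1 [LawlerSchrammWerner2004SAW].
* P. Billingsley, *Convergence of Probability Measures*, 2nd ed. (1999), Thm. 5.1 and Corollary.
-/

noncomputable section

open MeasureTheory Filter Topology Set
open scoped NNReal ENNReal
open Literature.Probability.RandomPlanarGeometry Literature.Probability.LatticeModels
open UpperHalfPlane (upperHalfPlaneSet)
open Summit.CriticalPhenomena.SAWScalingLimit.Theses.SAWLaplacianWalk

namespace Summit.CriticalPhenomena.SAWScalingLimit.Theorems

namespace SAWLaplacianWalkAssembly

/-- **The third marked point.** For a chordal uniformizing map `φ : ℍ → D` of a Dobrushin domain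
`(D; a, b)` and a real `x ≠ 0`, the Carathéodory boundary value `d₀ := φ.boundaryExtension x`
is a boundary point of `D`, different from `a = φ(0)` and from `b = φ(∞)`, and it is the boundary
value of `φ` at `x` (the disc extension of `φ` is a homeomorphism of the closed disc onto `cl D`,
injective on the boundary circle). [cite: PommerenkeBBCM1992, Thm. 2.6 (Carathéodory)] -/
theorem thirdPoint {D : DobrushinDomain} {φ : ConformalEquiv upperHalfPlaneSet D.carrier}
    (hφ : D.IsChordalUniformizing φ) {x : ℝ} (hx : x ≠ 0) :
    φ.boundaryExtension (x : ℂ) ∈ frontier D.carrier ∧ φ.boundaryExtension (x : ℂ) ≠ D.pt 0 ∧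
      φ.boundaryExtension (x : ℂ) ≠ D.pt 1 ∧
      φ.HasBoundaryValue (x : ℂ) (φ.boundaryExtension (x : ℂ)) := by
  obtain ⟨Φ, hΦ⟩ :=
    JordanDomain.exists_isDiscExtension JordanDomain.exists_continuousOn_extension_holds φ
  have hd₀mem : φ.boundaryExtension (x : ℂ) ∈ frontier D.carrier :=
    hΦ.boundaryExtension_ofReal_mem_frontier x
  refine ⟨hd₀mem, ?_, ?_, hΦ.tendsto_nhdsWithin (by simp)⟩
  · intro heq
    obtain ⟨t, -, ht⟩ := JordanDomain.exists_mem_Ico_boundary_eq D.toJordanDomain hd₀mem 0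
    have hx1 : JordanDomain.discParam D.toJordanDomain Φ t = x := hΦ.discParam_eq ht
    have h0 : φ.boundaryExtension ((0 : ℝ) : ℂ) = D.pt 0 := by
      rw [Complex.ofReal_zero]
      exact JordanDomain.boundaryExtension_eq_of_hasBoundaryValue' φ (by simp) hφ.1
    have hx0 : JordanDomain.discParam D.toJordanDomain Φ t = 0 :=
      hΦ.discParam_eq (ht.trans (heq.trans h0.symm))
    exact hx (hx1.symm.trans hx0)
  · rw [← hΦ.apply_one_eq hφ.2]
    exact hΦ.boundaryExtension_ofReal_ne x

/-- **Identification of subsequential limits.** Under the route items `BoundaryApprox`,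
`TipHarmonicLaw`, `HarmonicPassage`, `HarmonicIdentification`, `LimitsDescribable`: for every
Dobrushin domain with an endpoint approximation, every probability subsequential limit law `ν`
of the pushed-forward critical SAW laws (`IsSubseqLimitLaw`) is the chordal SLE_{8/3} law of `D`.
The cylinder identities of the harmonic `5/8`-observables are supplied for every real `x ≠ 0`
(third marked point `φ(x)`, lattice approximations from `BoundaryApprox`, passage from
`HarmonicPassage` fed with `TipHarmonicLaw`), an unbounded set of marked points, and
`HarmonicIdentification` concludes. [cite: CDHKSCRAS2014, Thm. 2 (martingale identification)] -/
theorem isSLELaw_of_isSubseqLimitLaw (hB : BoundaryApprox) (hK : TipHarmonicLaw)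
    (hP : HarmonicPassage) (hI : HarmonicIdentification) (hR : LimitsDescribable)
    {D : DobrushinDomain} {a b : ℝ → Site 2} (hab : SAW.IsEndpointApprox D a b)
    {μ : Measure (CurveClass ℂ)} (hμ : IsProbabilityMeasure μ)
    (hsub : IsSubseqLimitLaw (fun δ (γ : SAW.DomainSAW D.carrier δ (a δ) (b δ)) => γ.curve)
      (fun δ => SAW.law D.carrier δ (a δ) (b δ)) μ) :
    IsSLELaw ((8 : ℝ≥0) / 3) D μ := by
  obtain ⟨φ, hφ⟩ := MarkedDomain.exists_isChordalUniformizing_holds D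
  have hdesc := hR D a b hab φ hφ μ hμ hsub
  refine hI D φ μ {x : ℝ | x ≠ 0} hφ hμ hdesc ?_ ?_
  · rintro ⟨⟨M, hM⟩, -⟩
    have h1 : |M| + 1 ∈ {x : ℝ | x ≠ 0} := by
      simp only [ne_eq, Set.mem_setOf_eq]
      positivity
    have h2 := hM h1
    linarith [le_abs_self M]
  · intro x hx m s t hst n S hS ψ hψc hψb
    obtain ⟨hd₀mem, hd₀a, hd₀b, hbv⟩ := thirdPoint hφ (show x ≠ 0 from hx)
    obtain ⟨d, hdt, hdr⟩ := hB D a b hab _ hd₀mem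
    exact hP hK D a b d _ φ x μ hab hd₀mem hd₀a hd₀b hdt hdr hφ hbv hμ hsub hdesc m s t hst n S hS
      ψ hψc hψb

end SAWLaplacianWalkAssembly

/-! ### The item -/

open SAWLaplacianWalkAssembly in
/-- **Item `stmt-CriticalPhenomena-4487` (`SAWLaplacianWalk.Assembly`):
`BoundaryApprox → TipHarmonicLaw → HarmonicPassage → HarmonicIdentification → LimitsDescribable →
EventualTight → SAWScalingLimit`.** For each `(D, a, b)` with `IsEndpointApprox`, the tree's
Prokhorov/Billingsley criterion for the critical SAW laws
(`saw_convergesInLawToSLE_of_isTightAlongMesh`) applied to the tightness along the mesh given by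
`EventualTight` and to the identification of every probability subsequential limit law as the
chordal SLE_{8/3} law (`isSLELaw_of_isSubseqLimitLaw`, from the other five items) yields
`ConvergesInLawToSLE (8/3) D`, i.e. the conjunct `SAWScalingLimit`.
[cite: BillingsleyCPM1999, Thm. 5.1, Corollary] [cite: KemppainenSmirnov2017, Cor. 1.7] -/
theorem laplacianWalk_assembly_proof : Theses.SAWLaplacianWalk.Assembly := by
  unfold Theses.SAWLaplacianWalk.Assembly
  intro hB hK hP hI hR hT D a b hab
  exact saw_convergesInLawToSLE_of_isTightAlongMesh hab (hT D a b hab)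
    fun μ hμ hsub => isSLELaw_of_isSubseqLimitLaw hB hK hP hI hR hab hμ hsub

end Summit.CriticalPhenomena.SAWScalingLimit.Theorems

end
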